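import Mathlib.Data.List.Rotate
import Mathlib.Data.List.Perm.Basic
import Mathlib.Order.Lattice.Nat
import Mathlib.Algebra.Order.BigOperators.Group.Multiset
import Literature.GroupTheory.CombinatorialGroupTheory.CommutatorLengthCertificate
import HarnessLib

/-!
# Cyclic block interchange distance (Heuer 2020, §3.1)

N. Heuer, *Computing commutator length is hard*, arXiv:2001.10230 [Heuer2020], §3.1 (text held:
`lit read arxiv:2001.10230`, p. 7): for positive words `v, w ∈ A⁺`, "`w` is a *cyclic block
interchange* of `v` if there are cyclic permutations `v'` (resp. `w'`) of `v` (resp. of `w`) and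
words `w₁, w₂, w₃, w₄ ∈ A⁺ ∪ {∅}` with `v' = w₁ w₂ w₃ w₄` and `w' = w₁ w₄ w₃ w₂`"; `v, w` are
*related* if they contain the same number of each letter; "for two related words `v, w` we set
`d_cbi(v,w) = 0` if `w` is a cyclic permutation of `v`. Else, `d_cbi(v,w)` is the smallest `k`
such that there is a sequence `z⁰, …, zᵏ` with `z⁰ = v`, `zᵏ = w` and each `zⁱ` a cyclic block
interchange of `zⁱ⁻¹`", such a sequence existing for related words ("it is easy to see").

This file vendors these notions for `List α` (positive words = lists of letters, cyclic
permutation = Mathlib's `List.IsRotated`, related = `List.Perm`) and proves the elementary facts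
the decision problem CBI-`A` ([Heuer2020, §1]) and [Heuer2020, Thm. 2] rest on:

* `CBI.IsBlockInterchange`, `CBI.IsCBI` (the printed relations; reflexive, symmetric, invariant
  under cyclic permutation of either word, length- and letter-count-preserving), and the linear
  five-block form `w₁ w₂ w₃ w₄ w₅ ↦ w₁ w₄ w₃ w₂ w₅` of [Christie1996] as a special case up to
  rotation (`CBI.IsCBI.of_linear`);
* `CBI.Reach k v w` (a sequence of `k` cyclic block interchanges from `v` to a cyclic permutation
  of `w`; monotone in `k`, symmetric) and **the existence of such a sequence of length `|v|` for
  related words** (`CBI.reach_length_of_perm`: move the letters into place one at a time, each move a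
  block interchange of two blocks one of which is a single letter);
* `CBI.dcbi v w = sInf {k | Reach k v w}` with, for related words, `dcbi v w ≤ k ↔ Reach k v w`,
  `dcbi v w = 0 ↔ v ~r w`, `dcbi v w ≤ |v|`, symmetry, and the one-step triangle inequality
  `dcbi v w ≤ dcbi u w + 1` for a cyclic block interchange `u` of `v`.

Everything here is proved; no named facts. The orbit-counting formula for `d_cbi`
([Heuer2020, Thm. 2 (i)] via Bardakov pairings) and the NP-completeness of CBI
([Heuer2020, Thm. 3]) are not in this file.

## References

* [Heuer2020] N. Heuer, *Computing commutator length is hard*, arXiv:2001.10230, §1, §3.1.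
* [Christie1996] D. A. Christie, *Sorting permutations by block-interchanges*, Inform. Process.
  Lett. 60 (1996) 165–169 (linear block interchanges `w₁ w₂ w₃ w₄ w₅ ↦ w₁ w₄ w₃ w₂ w₅`).
-/

namespace Literature.GroupTheory.CombinatorialGroupTheory

namespace CBI

open List

variable {α : Type*}

/-! ### Block interchanges and cyclic block interchanges -/

/-- `w` is a (four-block) **block interchange** of `v`: `v = w₁ w₂ w₃ w₄` and `w = w₁ w₄ w₃ w₂`
for some (possibly empty) words `w₁, …, w₄`. [cite: Heuer2020, §3.1] -/
def IsBlockInterchange (v w : List α) : Prop :=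
  ∃ w₁ w₂ w₃ w₄ : List α, v = w₁ ++ w₂ ++ w₃ ++ w₄ ∧ w = w₁ ++ w₄ ++ w₃ ++ w₂

/-- `w` is a **cyclic block interchange** of `v`: some cyclic permutations `v' ~r v`, `w' ~r w`
form a block interchange. [cite: Heuer2020, §3.1] -/
def IsCBI (v w : List α) : Prop :=
  ∃ v' w' : List α, v' ~r v ∧ w' ~r w ∧ IsBlockInterchange v' w'

/-- A block interchange with empty exchanged blocks: every word is a block interchange of itself. [folklore] -/
theorem IsBlockInterchange.refl (v : List α) : IsBlockInterchange v v :=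
  ⟨v, [], [], [], by simp, by simp⟩

/-- Block interchange is a symmetric relation (exchange the blocks back). [folklore] -/
theorem IsBlockInterchange.symm {v w : List α} (h : IsBlockInterchange v w) : IsBlockInterchange w v := by
  obtain ⟨w₁, w₂, w₃, w₄, rfl, rfl⟩ := h
  exact ⟨w₁, w₄, w₃, w₂, rfl, rfl⟩

/-- A block interchange permutes the letters. [folklore] -/
theorem IsBlockInterchange.perm {v w : List α} (h : IsBlockInterchange v w) : v ~ w := by
  obtain ⟨w₁, w₂, w₃, w₄, rfl, rfl⟩ := h
  simp only [append_assoc]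
  refine Perm.append_left w₁ ?_
  calc w₂ ++ (w₃ ++ w₄) ~ w₃ ++ w₄ ++ w₂ := perm_append_comm
    _ = w₃ ++ (w₄ ++ w₂) := by rw [append_assoc]
    _ ~ w₄ ++ w₂ ++ w₃ := perm_append_comm
    _ ~ w₄ ++ (w₃ ++ w₂) := by
        rw [append_assoc]
        exact Perm.append_left w₄ perm_append_comm

/-- A block interchange preserves the length. [folklore] -/
theorem IsBlockInterchange.length_eq {v w : List α} (h : IsBlockInterchange v w) : v.length = w.length :=
  h.perm.length_eq

/-- A cyclic permutation is a cyclic block interchange (with empty exchanged blocks); in particular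
the relation is reflexive. [folklore] -/
theorem IsCBI.of_isRotated {v w : List α} (h : v ~r w) : IsCBI v w :=
  ⟨w, w, h.symm, IsRotated.refl w, IsBlockInterchange.refl w⟩

/-- Reflexivity. [folklore] -/
theorem IsCBI.refl (v : List α) : IsCBI v v := IsCBI.of_isRotated (IsRotated.refl v)

/-- Symmetry. [folklore] -/
theorem IsCBI.symm {v w : List α} (h : IsCBI v w) : IsCBI w v := by
  obtain ⟨v', w', hv, hw, h⟩ := h
  exact ⟨w', v', hw, hv, h.symm⟩

/-- Invariance under cyclic permutation of both words. [folklore] -/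
theorem IsCBI.of_isRotated_left_right {v w v₁ w₁ : List α} (h : IsCBI v w) (hv : v ~r v₁) (hw : w ~r w₁) :
    IsCBI v₁ w₁ := by
  obtain ⟨v', w', hv', hw', h⟩ := h
  exact ⟨v', w', hv'.trans hv, hw'.trans hw, h⟩

/-- `IsCBI` is invariant under cyclic permutations (iff form). [folklore] -/
theorem isCBI_congr {v w v₁ w₁ : List α} (hv : v ~r v₁) (hw : w ~r w₁) : IsCBI v w ↔ IsCBI v₁ w₁ :=
  ⟨fun h => h.of_isRotated_left_right hv hw, fun h => h.of_isRotated_left_right hv.symm hw.symm⟩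

/-- A cyclic block interchange permutes the letters (the words are related). [folklore] -/
theorem IsCBI.perm {v w : List α} (h : IsCBI v w) : v ~ w := by
  obtain ⟨v', w', hv, hw, h⟩ := h
  exact (hv.perm.symm.trans h.perm).trans hw.perm

/-- A cyclic block interchange preserves the length. [folklore] -/
theorem IsCBI.length_eq {v w : List α} (h : IsCBI v w) : v.length = w.length :=
  h.perm.length_eq

/-- A (four-block) block interchange is a cyclic block interchange. [folklore] -/
theorem IsBlockInterchange.isCBI {v w : List α} (h : IsBlockInterchange v w) : IsCBI v w :=
  ⟨v, w, IsRotated.refl v, IsRotated.refl w, h⟩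

/-- **The linear five-block interchange `w₁ w₂ w₃ w₄ w₅ ↦ w₁ w₄ w₃ w₂ w₅` of [Christie1996] is a
cyclic block interchange** (rotate `w₅` to the front and merge it with `w₁`). [cite: Heuer2020, Remark 3.2] -/
theorem IsCBI.of_linear {v w : List α} (w₁ w₂ w₃ w₄ w₅ : List α) (hv : v = w₁ ++ w₂ ++ w₃ ++ w₄ ++ w₅)
    (hw : w = w₁ ++ w₄ ++ w₃ ++ w₂ ++ w₅) : IsCBI v w := by
  subst hv hw
  refine ⟨(w₅ ++ w₁) ++ w₂ ++ w₃ ++ w₄, (w₅ ++ w₁) ++ w₄ ++ w₃ ++ w₂, ?_, ?_,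
    ⟨w₅ ++ w₁, w₂, w₃, w₄, rfl, rfl⟩⟩
  · have : w₅ ++ (w₁ ++ w₂ ++ w₃ ++ w₄) ~r (w₁ ++ w₂ ++ w₃ ++ w₄) ++ w₅ := isRotated_append
    simpa only [append_assoc] using this
  · have : w₅ ++ (w₁ ++ w₄ ++ w₃ ++ w₂) ~r (w₁ ++ w₄ ++ w₃ ++ w₂) ++ w₅ := isRotated_append
    simpa only [append_assoc] using this

/-- Moving one letter to the front past a block is a cyclic block interchange:
`w₁ y w₂ ↦ y w₁ w₂`. [folklore] -/
theorem IsCBI.move_front (w₁ : List α) (y : α) (w₂ : List α) : IsCBI (w₁ ++ y :: w₂) (y :: (w₁ ++ w₂)) :=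
  IsCBI.of_linear [] w₁ [] [y] w₂ (by simp) (by simp)

/-- Prefixing a common letter to a LINEAR five-block interchange keeps it one. [folklore] -/
theorem IsCBI.cons_of_linear {v w : List α} (x : α) (w₁ w₂ w₃ w₄ w₅ : List α)
    (hv : v = w₁ ++ w₂ ++ w₃ ++ w₄ ++ w₅) (hw : w = w₁ ++ w₄ ++ w₃ ++ w₂ ++ w₅) :
    IsCBI (x :: v) (x :: w) :=
  IsCBI.of_linear (x :: w₁) w₂ w₃ w₄ w₅ (by simp [hv]) (by simp [hw])

/-! ### Sequences of cyclic block interchanges -/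

/-- `Reach k v w`: there is a sequence of `k` cyclic block interchanges leading from `v` to a
cyclic permutation of `w` (`z⁰ = v`, `zⁱ` a cyclic block interchange of `zⁱ⁻¹`, `zᵏ ~r w`).
[cite: Heuer2020, §3.1] -/
def Reach : ℕ → List α → List α → Prop
  | 0, v, w => v ~r w
  | k + 1, v, w => ∃ u, IsCBI v u ∧ Reach k u w

/-- No steps: a cyclic permutation. [cite: Heuer2020, §3.1] -/
@[simp] theorem reach_zero {v w : List α} : Reach 0 v w ↔ v ~r w := Iff.rfl

/-- One more step, peeled at the front. [cite: Heuer2020, §3.1] -/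
theorem reach_succ {k : ℕ} {v w : List α} : Reach (k + 1) v w ↔ ∃ u, IsCBI v u ∧ Reach k u w := Iff.rfl

/-- Reachability permutes the letters. [folklore] -/
theorem Reach.perm : ∀ {k : ℕ} {v w : List α}, Reach k v w → v ~ w
  | 0, _, _, h => IsRotated.perm h
  | _ + 1, _, _, ⟨_, h₁, h₂⟩ => h₁.perm.trans h₂.perm

/-- Reachability is invariant under cyclic permutation of the target. [folklore] -/
theorem Reach.isRotated_right : ∀ {k : ℕ} {v w w' : List α}, Reach k v w → w ~r w' → Reach k v w'
  | 0, _, _, _, h, hw => IsRotated.trans h hw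
  | _ + 1, _, _, _, ⟨u, h₁, h₂⟩, hw => ⟨u, h₁, h₂.isRotated_right hw⟩

/-- Reachability is invariant under cyclic permutation of the source. [folklore] -/
theorem Reach.isRotated_left : ∀ {k : ℕ} {v v' w : List α}, Reach k v w → v ~r v' → Reach k v' w
  | 0, _, _, _, h, hv => hv.symm.trans h
  | _ + 1, _, _, _, ⟨u, h₁, h₂⟩, hv => ⟨u, h₁.of_isRotated_left_right hv (IsRotated.refl u), h₂⟩

/-- One more step, peeled at the back. [folklore] -/
theorem Reach.succ_right : ∀ {k : ℕ} {v u w : List α}, Reach k v u → IsCBI u w → Reach (k + 1) v w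
  | 0, _, _, w, h, huw => ⟨w, (huw.of_isRotated_left_right h.symm (IsRotated.refl w)), IsRotated.refl w⟩
  | _ + 1, _, _, _, ⟨z, h₁, h₂⟩, huw => ⟨z, h₁, h₂.succ_right huw⟩

/-- Monotonicity: padding with trivial interchanges. [folklore] -/
theorem Reach.mono : ∀ {k l : ℕ} {v w : List α}, Reach k v w → k ≤ l → Reach l v w
  | k, 0, _, _, h, hkl => by
    obtain rfl : k = 0 := Nat.le_zero.1 hkl
    exact h
  | 0, l + 1, v, w, h, _ => ⟨v, IsCBI.refl v, Reach.mono h (Nat.zero_le l)⟩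
  | k + 1, l + 1, _, _, ⟨u, h₁, h₂⟩, hkl => ⟨u, h₁, h₂.mono (Nat.le_of_succ_le_succ hkl)⟩

/-- Concatenation of sequences. [folklore] -/
theorem Reach.trans : ∀ {k l : ℕ} {v u w : List α}, Reach k v u → Reach l u w → Reach (k + l) v w
  | 0, l, _, _, _, h₁, h₂ => by
    rw [Nat.zero_add]
    exact h₂.isRotated_left h₁.symm
  | k + 1, l, _, _, _, ⟨z, h₁, h₂⟩, h₃ => by
    rw [Nat.add_right_comm]
    exact ⟨z, h₁, h₂.trans h₃⟩

/-- Symmetry of reachability (reverse the sequence). [folklore] -/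
theorem Reach.symm : ∀ {k : ℕ} {v w : List α}, Reach k v w → Reach k w v
  | 0, _, _, h => IsRotated.symm h
  | k + 1, v, w, ⟨u, h₁, h₂⟩ => by
    have h := (h₂.symm).succ_right h₁.symm
    exact h

/-- Linear five-block interchanges `w₁ w₂ w₃ w₄ w₅ ↦ w₁ w₄ w₃ w₂ w₅` ([Christie1996]); an
auxiliary notion for building sequences letter by letter. [folklore] -/
def IsLinear (v w : List α) : Prop :=
  ∃ w₁ w₂ w₃ w₄ w₅ : List α, v = w₁ ++ w₂ ++ w₃ ++ w₄ ++ w₅ ∧ w = w₁ ++ w₄ ++ w₃ ++ w₂ ++ w₅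

/-- A linear interchange is a cyclic block interchange. [folklore] -/
theorem IsLinear.isCBI {v w : List α} (h : IsLinear v w) : IsCBI v w := by
  obtain ⟨w₁, w₂, w₃, w₄, w₅, hv, hw⟩ := h
  exact IsCBI.of_linear w₁ w₂ w₃ w₄ w₅ hv hw

/-- Prefixing a common letter keeps a linear interchange linear. [folklore] -/
theorem IsLinear.cons {v w : List α} (x : α) (h : IsLinear v w) : IsLinear (x :: v) (x :: w) := by
  obtain ⟨w₁, w₂, w₃, w₄, w₅, rfl, rfl⟩ := h
  exact ⟨x :: w₁, w₂, w₃, w₄, w₅, by simp, by simp⟩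

/-- Moving one letter to the front past a block is a linear interchange: `w₁ y w₂ ↦ y w₁ w₂`. [folklore] -/
theorem IsLinear.move_front (w₁ : List α) (y : α) (w₂ : List α) : IsLinear (w₁ ++ y :: w₂) (y :: (w₁ ++ w₂)) :=
  ⟨[], w₁, [], [y], w₂, by simp, by simp⟩

/-- `LinReach k v w`: `w` is obtained from `v` by exactly `k` linear interchanges. [folklore] -/
def LinReach : ℕ → List α → List α → Prop
  | 0, v, w => v = w
  | k + 1, v, w => ∃ u, IsLinear v u ∧ LinReach k u w

/-- Prefixing a common letter to a whole linear sequence. [folklore] -/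
theorem LinReach.cons (x : α) : ∀ {k : ℕ} {v w : List α}, LinReach k v w → LinReach k (x :: v) (x :: w)
  | 0, _, _, h => congrArg (List.cons x) h
  | _ + 1, _, _, ⟨u, h₁, h₂⟩ => ⟨x :: u, h₁.cons x, h₂.cons x⟩

/-- A linear sequence is a sequence of cyclic block interchanges. [folklore] -/
theorem LinReach.reach : ∀ {k : ℕ} {v w : List α}, LinReach k v w → Reach k v w
  | 0, _, _, h => h ▸ IsRotated.refl _
  | _ + 1, _, _, ⟨u, h₁, h₂⟩ => ⟨u, h₁.isCBI, h₂.reach⟩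

/-- Related words are joined by `|v|` LINEAR interchanges: bring the letters of `w` to the front
of `v` one at a time (`w₁ y w₂ ↦ y w₁ w₂`), then recurse behind the placed letter. [folklore] -/
theorem linReach_length_of_perm : ∀ {v w : List α}, v ~ w → LinReach v.length v w
  | v, [], h => by
    obtain rfl := h.eq_nil
    rfl
  | v, y :: w, h => by
    obtain ⟨v₁, v₂, rfl⟩ := append_of_mem (h.mem_iff.2 (mem_cons_self))
    have hperm : v₁ ++ v₂ ~ w := by
      have h' : y :: (v₁ ++ v₂) ~ y :: w := (perm_middle.symm).trans h
      exact (perm_cons y).1 h'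
    have ih := (linReach_length_of_perm hperm).cons y
    have hlen : (v₁ ++ y :: v₂).length = (v₁ ++ v₂).length + 1 := by
      simp only [length_append, length_cons, Nat.add_assoc]
    rw [hlen]
    exact ⟨y :: (v₁ ++ v₂), IsLinear.move_front v₁ y v₂, ih⟩

/-- **Related words are joined by a sequence of `|v|` cyclic block interchanges** ("it is easy to
see that for two related words there is a sequence of cyclic block interchanges",
[Heuer2020, §3.1]). [cite: Heuer2020, §3.1] -/
theorem reach_length_of_perm {v w : List α} (h : v ~ w) : Reach v.length v w :=
  (linReach_length_of_perm h).reach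

/-! ### The cyclic block interchange distance -/

/-- **The cyclic block interchange distance** `d_cbi(v, w)`: the least `k` with `Reach k v w`
(`0` iff `w` is a cyclic permutation of `v`; for unrelated words the set is empty and the value is
the junk value `sInf ∅ = 0`). [cite: Heuer2020, §3.1] -/
noncomputable def dcbi (v w : List α) : ℕ :=
  sInf {k | Reach k v w}

/-- A sequence of length `k` bounds the distance. [folklore] -/
theorem dcbi_le_of_reach {k : ℕ} {v w : List α} (h : Reach k v w) : dcbi v w ≤ k :=
  Nat.sInf_le h

/-- For related words the distance is attained. [folklore] -/
theorem reach_dcbi {v w : List α} (h : v ~ w) : Reach (dcbi v w) v w :=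
  Nat.sInf_mem (s := {k | Reach k v w}) ⟨v.length, reach_length_of_perm h⟩

/-- **`d_cbi(v,w) ≤ k` iff a sequence of `k` cyclic block interchanges joins them** (related words).
[cite: Heuer2020, §3.1] -/
theorem dcbi_le_iff {v w : List α} (h : v ~ w) {k : ℕ} : dcbi v w ≤ k ↔ Reach k v w :=
  ⟨fun hk => (reach_dcbi h).mono hk, dcbi_le_of_reach⟩

/-- **`d_cbi(v,w) = 0` iff `w` is a cyclic permutation of `v`** (related words). [cite: Heuer2020, §3.1] -/
theorem dcbi_eq_zero_iff {v w : List α} (h : v ~ w) : dcbi v w = 0 ↔ v ~r w := by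
  rw [← Nat.le_zero, dcbi_le_iff h, reach_zero]

/-- `d_cbi(v,w) ≤ |v|` for related words. [cite: Heuer2020, §3.1] -/
theorem dcbi_le_length {v w : List α} (h : v ~ w) : dcbi v w ≤ v.length :=
  dcbi_le_of_reach (reach_length_of_perm h)

/-- The distance is symmetric. [folklore] -/
theorem dcbi_comm (v w : List α) : dcbi v w = dcbi w v := by
  unfold dcbi
  exact congrArg sInf (Set.ext fun k => ⟨Reach.symm, Reach.symm⟩)

/-- The distance only depends on the words up to cyclic permutation. [folklore] -/
theorem dcbi_congr {v w v' w' : List α} (hv : v ~r v') (hw : w ~r w') : dcbi v w = dcbi v' w' := by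
  unfold dcbi
  exact congrArg sInf (Set.ext fun k => ⟨fun h => (h.isRotated_left hv).isRotated_right hw,
    fun h => (h.isRotated_left hv.symm).isRotated_right hw.symm⟩)

/-- **One-step triangle inequality**: if `u` is a cyclic block interchange of `v` then
`d_cbi(v,w) ≤ d_cbi(u,w) + 1` (related words). [folklore] -/
theorem dcbi_le_dcbi_add_one {v u w : List α} (hvu : IsCBI v u) (huw : u ~ w) :
    dcbi v w ≤ dcbi u w + 1 :=
  dcbi_le_of_reach ⟨u, hvu, reach_dcbi huw⟩

/-- A cyclic block interchange of `v` is at distance at most one. [folklore] -/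
theorem dcbi_le_one_of_isCBI {v w : List α} (h : IsCBI v w) : dcbi v w ≤ 1 :=
  dcbi_le_of_reach ⟨w, h, IsRotated.refl w⟩

/-- Sanity instance ([Heuer2020, Example 3.1]): `a b a b a b ↦ a a a b b b` is a cyclic block
interchange (`v' = b a · b · a b · a`, `w' = b a · a · a b · b`), so the distance is at most one. -/
example : dcbi [0, 1, 0, 1, 0, 1] [0, 0, 0, 1, 1, (1 : Fin 2)] ≤ 1 :=
  dcbi_le_one_of_isCBI ⟨[1, 0, 1, 0, 1, 0], [1, 0, 0, 0, 1, 1], ⟨1, rfl⟩, ⟨1, rfl⟩,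
    ⟨[1, 0], [1], [0, 1], [0], rfl, rfl⟩⟩


/-! ### Letter matchings and the two-circle model of [Heuer2020, §3.2]

For words `v, w` of the same length `n` read on two circles — `v = x_{0⁺} ⋯ x_{(n-1)⁺}` and
`w = x_{0⁻} ⋯ x_{(n-1)⁻}`, index set `I = I⁺ ⊔ I⁻` ([Heuer2020, Remark 3.4]) — a Bardakov
pairing of the chain `v + w⁻¹` matches each position `i⁺` of `v` with a position `π(i⁺) ∈ I⁻`
carrying the same letter ("`π(I⁻) = I⁺` and `x_{π(i⁺)} = x_{i⁺}`", loc. cit. §3.2); we record it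
as a permutation `p` of `Fin n` (`i⁺ ↦ (p i)⁻`) with `w[p i] = v[i]` (`CBI.IsMatching`). The
map `σ` is `x ↦ x + 1` on `I⁺` and `x ↦ x - 1` on `I⁻` (`CBI.sigma`), the pairing as an
involution of `I` is `CBI.pairing p`, and `α = σπ` is `CBI.alpha p`; Bardakov's formula for the
chain reads `cl(v + w⁻¹) = min_π (n/2 − orb(σπ)/2)` (loc. cit. §3.2, display after Remark 3.4).
Here: `α` has no fixed points, so it has at most `n` cycles (`CBI.two_mul_ncyc_alpha_le`), with
equality iff `α² = 1` (`CBI.alpha_sq_eq_one_iff`), iff the matching is a rotation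
(`CBI.alpha_sq_eq_one_iff_exists_pow`), which happens for some matching iff `w` is a cyclic
permutation of `v` (`CBI.exists_isMatching_ncyc_eq_iff`) — the case "`α²(x) = x` for all `x`:
then `v` and `w` are cyclic conjugates" of [Heuer2020, Lemma 3.5 / Claim 3.9]. -/

section TwoCircle

open Equiv Equiv.Perm Bardakov

variable {n : ℕ}

/-- `σ` on `I⁺ ⊔ I⁻`: `i⁺ ↦ (i+1)⁺`, `j⁻ ↦ (j-1)⁻`. [cite: Heuer2020, §3.2] -/
def sigma (n : ℕ) : Perm (Fin n ⊕ Fin n) := Equiv.sumCongr (finRotate n) (finRotate n).symm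

/-- The pairing of `I⁺ ⊔ I⁻` determined by a matching `p`: `i⁺ ↔ (p i)⁻`. [cite: Heuer2020, §3.2] -/
def pairing (p : Perm (Fin n)) : Perm (Fin n ⊕ Fin n) :=
  (Equiv.sumCongr p p.symm).trans (Equiv.sumComm (Fin n) (Fin n))

/-- `α = σπ`. [cite: Heuer2020, §3.2] -/
def alpha (p : Perm (Fin n)) : Perm (Fin n ⊕ Fin n) := sigma n * pairing p

/-- `p` matches the letters of `V` (on `I⁺`) with equal letters of `W` (on `I⁻`). [cite: Heuer2020, §3.2] -/
def IsMatching (V W : Fin n → α) (p : Perm (Fin n)) : Prop := ∀ i, W (p i) = V i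

/-- `π(i⁺) = (p i)⁻`. [cite: Heuer2020, §3.2] -/
@[simp] theorem pairing_inl (p : Perm (Fin n)) (i : Fin n) : pairing p (Sum.inl i) = Sum.inr (p i) := rfl

/-- `π(j⁻) = (p⁻¹ j)⁺`. [cite: Heuer2020, §3.2] -/
@[simp] theorem pairing_inr (p : Perm (Fin n)) (j : Fin n) : pairing p (Sum.inr j) = Sum.inl (p.symm j) := rfl

/-- `σ(i⁺) = (i+1)⁺`. [cite: Heuer2020, §3.2] -/
@[simp] theorem sigma_inl (i : Fin n) : sigma n (Sum.inl i) = Sum.inl (finRotate n i) := rfl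

/-- `σ(j⁻) = (j-1)⁻`. [cite: Heuer2020, §3.2] -/
@[simp] theorem sigma_inr (j : Fin n) : sigma n (Sum.inr j) = Sum.inr ((finRotate n).symm j) := rfl

/-- `α(i⁺) = (p i − 1)⁻`. [cite: Heuer2020, §3.2] -/
@[simp] theorem alpha_inl (p : Perm (Fin n)) (i : Fin n) :
    alpha p (Sum.inl i) = Sum.inr ((finRotate n).symm (p i)) := rfl

/-- `α(j⁻) = (p⁻¹ j + 1)⁺`. [cite: Heuer2020, §3.2] -/
@[simp] theorem alpha_inr (p : Perm (Fin n)) (j : Fin n) :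
    alpha p (Sum.inr j) = Sum.inl (finRotate n (p.symm j)) := rfl

/-- The pairing is an involution. [folklore] -/
theorem pairing_mul_self (p : Perm (Fin n)) : pairing p * pairing p = 1 := by
  ext x
  rcases x with i | j <;> simp

/-- `α` exchanges the two circles; in particular it has no fixed points. [folklore] -/
theorem alpha_apply_ne_self (p : Perm (Fin n)) (x : Fin n ⊕ Fin n) : alpha p x ≠ x := by
  rcases x with i | j <;> simp

/-- `α²` on `I⁺`. [folklore] -/
theorem alpha_alpha_inl (p : Perm (Fin n)) (i : Fin n) :
    alpha p (alpha p (Sum.inl i)) = Sum.inl (finRotate n (p.symm ((finRotate n).symm (p i)))) := rfl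

/-! #### Fixed-point-free permutations: at most `|β|/2` cycles, with equality iff an involution -/

/-- A multiset of naturals `≥ 2` summing to twice its cardinality consists of `2`s. [folklore] -/
theorem eq_two_of_sum_eq {m : Multiset ℕ} (h2 : ∀ x ∈ m, 2 ≤ x) (hs : m.sum = 2 * Multiset.card m)
    {x : ℕ} (hx : x ∈ m) : x = 2 := by
  obtain ⟨t, rfl⟩ := Multiset.exists_cons_of_mem hx
  have ht : Multiset.card t • 2 ≤ t.sum := Multiset.card_nsmul_le_sum fun y hy => h2 y (Multiset.mem_cons_of_mem hy)
  rw [Multiset.sum_cons, Multiset.card_cons] at hs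
  rw [smul_eq_mul] at ht
  have := h2 x hx
  omega

variable {β : Type*} [Fintype β] [DecidableEq β]

/-- A fixed-point-free permutation has at most `|β|/2` cycles (every cycle has length `≥ 2`). [folklore] -/
theorem two_mul_ncyc_le_card {f : Perm β} (hf : ∀ x, f x ≠ x) : 2 * ncyc f ≤ Fintype.card β := by
  have h0 : Fintype.card {x // f x = x} = 0 := Fintype.card_eq_zero_iff.2 ⟨fun x => hf x.1 x.2⟩
  have hc : ncyc f = Multiset.card f.cycleType := by
    rw [ncyc_eq_card_add_card, h0, Nat.add_zero, cycleType_def, Multiset.card_map]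
    rfl
  have h1 : Multiset.card f.cycleType • 2 ≤ f.cycleType.sum :=
    Multiset.card_nsmul_le_sum fun y hy => two_le_of_mem_cycleType hy
  rw [smul_eq_mul] at h1
  have h2 := f.sum_cycleType_le
  rw [hc]
  omega

/-- A fixed-point-free permutation with exactly `|β|/2` cycles is an involution. [folklore] -/
theorem sq_eq_one_of_two_mul_ncyc_eq {f : Perm β} (hf : ∀ x, f x ≠ x) (h : 2 * ncyc f = Fintype.card β) :
    f ^ 2 = 1 := by
  have h0 : Fintype.card {x // f x = x} = 0 := Fintype.card_eq_zero_iff.2 ⟨fun x => hf x.1 x.2⟩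
  have hc : ncyc f = Multiset.card f.cycleType := by
    rw [ncyc_eq_card_add_card, h0, Nat.add_zero, cycleType_def, Multiset.card_map]
    rfl
  have h1 : Multiset.card f.cycleType • 2 ≤ f.cycleType.sum :=
    Multiset.card_nsmul_le_sum fun y hy => two_le_of_mem_cycleType hy
  rw [smul_eq_mul] at h1
  have h2 := f.sum_cycleType_le
  have hs : f.cycleType.sum = 2 * Multiset.card f.cycleType := by rw [← hc]; omega
  have hall : ∀ x ∈ f.cycleType, x = 2 := fun x hx => eq_two_of_sum_eq (fun y hy => two_le_of_mem_cycleType hy) hs hx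
  have hdvd : orderOf f ∣ 2 := by
    rw [← lcm_cycleType]
    exact Multiset.lcm_dvd.2 fun x hx => by rw [hall x hx]
  exact orderOf_dvd_iff_pow_eq_one.1 hdvd

/-- A fixed-point-free involution has exactly `|β|/2` cycles. [folklore] -/
theorem two_mul_ncyc_eq_card_of_sq_eq_one {f : Perm β} (hf : ∀ x, f x ≠ x) (h : f ^ 2 = 1) :
    2 * ncyc f = Fintype.card β := by
  have h0 : Fintype.card {x // f x = x} = 0 := Fintype.card_eq_zero_iff.2 ⟨fun x => hf x.1 x.2⟩
  have hc : ncyc f = Multiset.card f.cycleType := by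
    rw [ncyc_eq_card_add_card, h0, Nat.add_zero, cycleType_def, Multiset.card_map]
    rfl
  have hord : orderOf f ∣ 2 := orderOf_dvd_of_pow_eq_one h
  have hall : ∀ x ∈ f.cycleType, x = 2 := fun x hx => by
    have hx2 := two_le_of_mem_cycleType hx
    have hxd : x ∣ 2 := (dvd_of_mem_cycleType hx).trans hord
    have := Nat.le_of_dvd two_pos hxd
    omega
  have hsum : f.cycleType.sum = Multiset.card f.cycleType * 2 := by
    rw [← smul_eq_mul, ← Multiset.sum_replicate, ← Multiset.eq_replicate_card.2 hall]
  have hsupp : f.support = Finset.univ := Finset.eq_univ_of_forall fun x => mem_support.2 (hf x)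
  have hs := f.sum_cycleType
  rw [hsupp, Finset.card_univ] at hs
  rw [hc]
  omega

/-! #### `α` has at most `n` cycles, with equality iff the matching is a rotation -/

/-- **`orb(σπ) ≤ n`.** [cite: Heuer2020, §3.2] -/
theorem ncyc_alpha_le (p : Perm (Fin n)) : ncyc (alpha p) ≤ n := by
  have := two_mul_ncyc_le_card (alpha_apply_ne_self p)
  rw [Fintype.card_sum, Fintype.card_fin] at this
  omega

/-- **`orb(σπ) = n` iff `α² = 1`.** [cite: Heuer2020, Lemma 3.5] -/
theorem ncyc_alpha_eq_iff (p : Perm (Fin n)) : ncyc (alpha p) = n ↔ alpha p ^ 2 = 1 := by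
  constructor
  · intro h
    refine sq_eq_one_of_two_mul_ncyc_eq (alpha_apply_ne_self p) ?_
    rw [Fintype.card_sum, Fintype.card_fin, h, two_mul]
  · intro h
    have := two_mul_ncyc_eq_card_of_sq_eq_one (alpha_apply_ne_self p) h
    rw [Fintype.card_sum, Fintype.card_fin] at this
    omega

/-- `α² = 1` iff `p` commutes with the rotation. [folklore] -/
theorem alpha_sq_eq_one_iff (p : Perm (Fin n)) :
    alpha p ^ 2 = 1 ↔ ∀ i, p (finRotate n i) = finRotate n (p i) := by
  constructor
  · intro h k
    rw [pow_two] at h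
    have h0 := Equiv.ext_iff.1 h (Sum.inl (finRotate n k))
    rw [Perm.mul_apply, Perm.one_apply, alpha_alpha_inl, Sum.inl.injEq] at h0
    have h1 : p.symm ((finRotate n).symm (p (finRotate n k))) = k := (finRotate n).injective h0
    rw [Equiv.symm_apply_eq, Equiv.symm_apply_eq] at h1
    exact h1
  · intro h
    rw [pow_two]
    ext x
    rcases x with i | j
    · rw [Perm.mul_apply, alpha_alpha_inl, Perm.one_apply, Sum.inl.injEq]
      have hm := h (p.symm ((finRotate n).symm (p i)))
      rw [Equiv.apply_symm_apply, Equiv.apply_symm_apply] at hm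
      exact p.injective hm
    · rw [Perm.mul_apply, alpha_inr, alpha_inl, Perm.one_apply, Sum.inr.injEq, h, Equiv.apply_symm_apply,
        Equiv.symm_apply_apply]

/-- Commuting with the rotation means being a rotation. [folklore] -/
theorem forall_apply_finRotate_iff (p : Perm (Fin n)) :
    (∀ i, p (finRotate n i) = finRotate n (p i)) ↔ ∃ c : ℕ, p = (finRotate n) ^ c := by
  constructor
  · intro h
    rcases Nat.eq_zero_or_pos n with rfl | hn
    · exact ⟨0, Subsingleton.elim _ _⟩
    · have hk : ∀ (k : ℕ) (i : Fin n), p (((finRotate n) ^ k) i) = ((finRotate n) ^ k) (p i) := by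
        intro k
        induction k with
        | zero => intro i; simp
        | succ k ih => intro i; rw [pow_succ, Perm.mul_apply, Perm.mul_apply, ih, h]
      refine ⟨(p ⟨0, hn⟩).val, Equiv.ext fun i => Fin.ext ?_⟩
      have hi : i = ((finRotate n) ^ i.val) ⟨0, hn⟩ :=
        Fin.ext (by rw [val_finRotate_pow, Nat.zero_add, Nat.mod_eq_of_lt i.isLt])
      conv_lhs => rw [hi, hk]
      rw [val_finRotate_pow, val_finRotate_pow, Nat.add_comm]
  · rintro ⟨c, rfl⟩ i
    rw [← Perm.mul_apply, ← Perm.mul_apply, (Commute.self_pow (finRotate n) c).eq]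

/-- **`α² = 1` iff the matching is a rotation `i ↦ i + c`.** [cite: Heuer2020, Lemma 3.5] -/
theorem alpha_sq_eq_one_iff_exists_pow (p : Perm (Fin n)) :
    alpha p ^ 2 = 1 ↔ ∃ c : ℕ, p = (finRotate n) ^ c :=
  (alpha_sq_eq_one_iff p).trans (forall_apply_finRotate_iff p)

/-- The rotated word as a list is `List.rotate`. [folklore] -/
theorem ofFn_comp_finRotate_pow' (W : Fin n → α) (k : ℕ) :
    List.ofFn (W ∘ ((finRotate n) ^ k)) = (List.ofFn W).rotate k := by
  apply List.ext_getElem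
  · simp
  · intro i h₁ h₂
    rw [List.getElem_ofFn, List.getElem_rotate]
    simp only [Function.comp_apply, List.length_ofFn, List.getElem_ofFn]
    congr 1
    ext
    rw [val_finRotate_pow]

/-- A rotation matches the letters iff the words are the corresponding cyclic permutations of
each other. [folklore] -/
theorem isMatching_pow_iff (V W : Fin n → α) (c : ℕ) :
    IsMatching V W ((finRotate n) ^ c) ↔ (List.ofFn W).rotate c = List.ofFn V := by
  rw [← ofFn_comp_finRotate_pow', List.ofFn_inj]
  exact ⟨fun h => funext h, fun h i => congrFun h i⟩

/-- **Related words admit a matching** (glue bijections between the letter fibres). [folklore] -/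
theorem exists_isMatching_of_perm [DecidableEq α] {V W : Fin n → α} (h : List.ofFn V ~ List.ofFn W) : ∃ p, IsMatching V W p := by
  have hcard : ∀ a, Fintype.card {i // V i = a} = Fintype.card {i // W i = a} := by
    intro a
    rw [Fintype.card_subtype, Fintype.card_subtype, ← count_ofFn, ← count_ofFn]
    exact h.count_eq a
  exact ⟨Equiv.ofFiberEquiv fun a => Fintype.equivOfCardEq (hcard a),
    fun i => Equiv.ofFiberEquiv_map (fun a => Fintype.equivOfCardEq (hcard a)) i⟩

/-- A matching makes the words related. [folklore] -/
theorem IsMatching.perm {V W : Fin n → α} {p : Perm (Fin n)} (h : IsMatching V W p) :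
    List.ofFn V ~ List.ofFn W := by
  have hV : V = W ∘ p := funext fun i => (h i).symm
  rw [hV]
  exact Equiv.Perm.ofFn_comp_perm p W

/-- **Genus zero**: some matching has `orb(σπ) = n` iff `w` is a cyclic permutation of `v`
("`α²(x) = x` for all `x`: then `v` and `w` are cyclic conjugates", [Heuer2020, proof of
Claim 3.9]; conversely a rotation matching has `α² = 1`). [cite: Heuer2020, Claim 3.9] -/
theorem exists_isMatching_ncyc_eq_iff (V W : Fin n → α) :
    (∃ p, IsMatching V W p ∧ ncyc (alpha p) = n) ↔ List.ofFn W ~r List.ofFn V := by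
  constructor
  · rintro ⟨p, hm, hc⟩
    obtain ⟨c, rfl⟩ := (alpha_sq_eq_one_iff_exists_pow p).1 ((ncyc_alpha_eq_iff p).1 hc)
    exact ⟨c, (isMatching_pow_iff V W c).1 hm⟩
  · rintro ⟨c, hc⟩
    refine ⟨(finRotate n) ^ c, (isMatching_pow_iff V W c).2 hc, ?_⟩
    rw [ncyc_alpha_eq_iff, alpha_sq_eq_one_iff_exists_pow]
    exact ⟨c, rfl⟩

/-- **The distance vanishes iff some matching has `n` orbits.** [cite: Heuer2020, Claim 3.9] -/
theorem dcbi_ofFn_eq_zero_iff {V W : Fin n → α} (h : List.ofFn V ~ List.ofFn W) :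
    dcbi (List.ofFn V) (List.ofFn W) = 0 ↔ ∃ p, IsMatching V W p ∧ ncyc (alpha p) = n := by
  rw [dcbi_eq_zero_iff h, exists_isMatching_ncyc_eq_iff, isRotated_comm]

end TwoCircle

end CBI

end Literature.GroupTheory.CombinatorialGroupTheory
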